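import Summits.QuantumFields.GaugeBoot.CubePlaquettes
import Summits.QuantumFields.GaugeBoot.LogPartitionFunction
import HarnessLib

/-!
# The average plaquette value of a cube in the 't Hooft limit (gauge-boot, ADDENDUM 28 part Z5)

HONEST FRAMING (cell `pub-gaugeboot`, page 1 of every file): the venture produces certified bounds
on lattice expectations at stated coupling, gauge group, dimension and torus size; NOT a mass gap,
NOT a continuum limit, NOT a string tension; NOT Yang–Mills-summit-bearing (barriers
`FixedCouplingUltralocality`, `PerturbativeInvisibility`).  Strong-coupling large-`N` `SO(N)` lattice gauge theory with free
boundary condition (S. Chatterjee, Comm. Math. Phys. **366** (2019), §15); nothing about four-dimensional continuum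
Yang–Mills or a mass gap.

## Content

* `hasDerivAt_integral_mul_exp_soRep`, `continuous_phi_coupling` — `β ↦ φ_{Λ,N,β}(s)` is continuous (a ratio of Haar
  integrals of `e^{NβS}`, differentiable under the integral sign);
* ★ `tendsto_avg_phi_plaquette` — for `|t| ≤ β₀(d)`, cubes `Λ_N = [−M_N, M_N]^d` with `M_N → ∞`, and any plaquette `p`,
  `|Λ_N|⁻¹ Σ_{q ∈ 𝒫_{Λ_N}} φ_{Λ_N,N,t}((∂q)) → (d(d−1)/2) Σ_{X ∈ 𝒳((∂p))} w_t(X)`: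
  the interior plaquettes (depth `R`) are within `C⁴(3(3/4)^R + 20/N)` of the string sum by the lane's quantitative
  duality (`abs_phi_sub_trajectorySum_le_of_ball`), the string sum does not depend on the plaquette
  (`trajectorySum_plaquetteWord_eq`), and the boundary layer has vanishing density (`tendsto_card_box_ratio`).  This is the
  free-boundary replacement for the torus symmetry argument of the source's §15.

Everything is `[folklore]` given the source and the siblings.
-/

noncomputable section

open MeasureTheory Filter Topology
open Literature.Probability.LatticeModels (Site box)
open Literature.MathematicalPhysics.QuantumLattice (LGConfig ZdEdge ZdPlaquette)
open Literature.MathematicalPhysics.QuantumFieldTheory (ZdGaugeConfig zdHaar zdWilsonAction zdExpect latticeNorm plaquettesIn)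
open Literature.MathematicalPhysics.QuantumFieldTheory.AreaLaw (integrable_zdHaar_of_continuous continuous_plaquette
  zdExpect_eq_div_integral)
open Literature.MathematicalPhysics.QuantumFieldTheory.Chatterjee2019LargeN

namespace Summit.QuantumFields.GaugeBoot

namespace StringDuality

variable {d N : ℕ}

/-! ## Continuity of the expectations in the coupling -/

/-- Differentiation under the Haar integral with a bounded continuous factor: `β ↦ ∫ G e^{cβS} dg_∞` has derivative
`∫ G·cS·e^{cβS} dg_∞`. [folklore] -/
theorem hasDerivAt_integral_mul_exp_soRep {S G : ZdGaugeConfig d (SO N) → ℝ} (hS : Continuous S) (hG : Continuous G)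
    {B : ℝ} (hB : ∀ U, |S U| ≤ B) {A : ℝ} (hA : ∀ U, |G U| ≤ A) (c β₀ : ℝ) :
    HasDerivAt (fun β : ℝ => ∫ U, G U * Real.exp (c * β * S U) ∂(zdHaar d (SO N)))
      (∫ U, G U * (c * S U) * Real.exp (c * β₀ * S U) ∂(zdHaar d (SO N))) β₀ := by
  have hB0 : 0 ≤ B := (abs_nonneg _).trans (hB 1)
  have hA0 : 0 ≤ A := (abs_nonneg _).trans (hA 1)
  set bound : ZdGaugeConfig d (SO N) → ℝ := fun _ => A * (|c| * B) * Real.exp (|c| * (|β₀| + 1) * B) with hbound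
  have hcont : ∀ β : ℝ, Continuous fun U => G U * Real.exp (c * β * S U) := fun β =>
    hG.mul (Real.continuous_exp.comp (continuous_const.mul hS))
  have hcont' : ∀ β : ℝ, Continuous fun U => G U * (c * S U) * Real.exp (c * β * S U) := fun β =>
    (hG.mul (continuous_const.mul hS)).mul (Real.continuous_exp.comp (continuous_const.mul hS))
  have h := hasDerivAt_integral_of_dominated_loc_of_deriv_le (μ := zdHaar d (SO N)) (x₀ := β₀)
    (F := fun β U => G U * Real.exp (c * β * S U))
    (F' := fun β U => G U * (c * S U) * Real.exp (c * β * S U)) (bound := bound)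
    (Metric.ball_mem_nhds β₀ zero_lt_one)
    (Eventually.of_forall fun β => (hcont β).aestronglyMeasurable)
    (integrable_zdHaar_of_continuous (hcont β₀)) (hcont' β₀).aestronglyMeasurable ?_
    (integrable_const _) ?_
  · exact h.2
  · refine ae_of_all _ fun U β hβ => ?_
    rw [Metric.mem_ball, Real.dist_eq] at hβ
    have hβ' : |β| ≤ |β₀| + 1 := by
      have := abs_sub_abs_le_abs_sub β β₀
      linarith
    have hcS : |c * S U| ≤ |c| * B := by rw [abs_mul]; exact mul_le_mul_of_nonneg_left (hB U) (abs_nonneg c)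
    rw [Real.norm_eq_abs, abs_mul, abs_mul, Real.abs_exp, hbound]
    refine mul_le_mul (mul_le_mul (hA U) hcS (abs_nonneg _) hA0) (Real.exp_le_exp.mpr ?_) (Real.exp_pos _).le
      (by positivity)
    calc c * β * S U ≤ |c * β * S U| := le_abs_self _
      _ = |β| * |c * S U| := by rw [show c * β * S U = β * (c * S U) by ring, abs_mul]
      _ ≤ (|β₀| + 1) * (|c| * B) := mul_le_mul hβ' hcS (abs_nonneg _) (by positivity)
      _ = |c| * (|β₀| + 1) * B := by ring
  · refine ae_of_all _ fun U β _ => ?_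
    have h1 : HasDerivAt (fun β : ℝ => c * β * S U) (c * S U) β := by
      have := ((hasDerivAt_id β).const_mul c).mul_const (S U)
      simpa using this
    have h2 := (h1.exp).const_mul (G U)
    have e : G U * (Real.exp (c * β * S U) * (c * S U)) = G U * (c * S U) * Real.exp (c * β * S U) := by ring
    rw [e] at h2
    exact h2

/-- The `SO(N)` expectation as a ratio of Haar integrals of `e^{Nβ Σ_p tr Q_p}` (the constant `e^{−N²β|𝒫|}` cancels).
[cite: Chatterjee2019LargeN, §3 eq. (3.1)] -/
theorem soExpect_eq_div (β : ℝ) (Λ : Finset (Site d)) (F : ZdGaugeConfig d (SO N) → ℝ) :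
    soExpect N β Λ F =
      (∫ U, F U * Real.exp (N * β * ∑ p ∈ plaquettesIn Λ,
          Matrix.trace ((ZdGaugeConfig.plaquette U p.1 p.2.1 p.2.2 : SO N) : Matrix (Fin N) (Fin N) ℝ)) ∂(zdHaar d (SO N))) /
        ∫ U, Real.exp (N * β * ∑ p ∈ plaquettesIn Λ,
          Matrix.trace ((ZdGaugeConfig.plaquette U p.1 p.2.1 p.2.2 : SO N) : Matrix (Fin N) (Fin N) ℝ)) ∂(zdHaar d (SO N)) := by
  have hρ : Continuous (soRep N) := (isSpecialOrthogonalModel_soRep N).1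
  have hc : Real.exp (-(N * β) * (N * (plaquettesIn Λ).card)) ≠ 0 := (Real.exp_pos _).ne'
  rw [soExpect_eq_zdExpect, zdExpect_eq_div_integral (soRep N) hρ (N * β) Λ F]
  simp_rw [exp_neg_mul_zdWilsonAction_soRep]
  have h1 : (∫ U, F U * (Real.exp (-(N * β) * (N * (plaquettesIn Λ).card)) * Real.exp (N * β * ∑ p ∈ plaquettesIn Λ,
      Matrix.trace ((ZdGaugeConfig.plaquette U p.1 p.2.1 p.2.2 : SO N) : Matrix (Fin N) (Fin N) ℝ))) ∂(zdHaar d (SO N))) =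
      Real.exp (-(N * β) * (N * (plaquettesIn Λ).card)) * ∫ U, F U * Real.exp (N * β * ∑ p ∈ plaquettesIn Λ,
        Matrix.trace ((ZdGaugeConfig.plaquette U p.1 p.2.1 p.2.2 : SO N) : Matrix (Fin N) (Fin N) ℝ)) ∂(zdHaar d (SO N)) := by
    rw [← integral_const_mul]
    refine integral_congr_ae (ae_of_all _ fun U => ?_)
    ring
  rw [h1, integral_const_mul, mul_div_mul_left _ _ hc]

variable (N) in
/-- **`β ↦ φ_{Λ,N,β}(s)` is continuous.** [folklore] -/
theorem continuous_phi_coupling (Λ : Finset (Site d)) (s : LoopSeq d) : Continuous fun β : ℝ => phi N β Λ s := by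
  -- the total plaquette trace and the Wilson product are continuous and bounded
  set S : ZdGaugeConfig d (SO N) → ℝ := fun U => ∑ p ∈ plaquettesIn Λ,
    Matrix.trace ((ZdGaugeConfig.plaquette U p.1 p.2.1 p.2.2 : SO N) : Matrix (Fin N) (Fin N) ℝ) with hSdef
  have hS : Continuous S := by
    rw [hSdef]
    exact continuous_finsetSum _ fun p _ =>
      (continuous_subtype_val.comp (continuous_plaquette p.1 p.2.1 p.2.2)).matrix_trace
  have hW : Continuous fun U : ZdGaugeConfig d (SO N) => wilsonProd N s U := SOMasterLoop.continuous_wilsonProd (N := N) s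
  obtain ⟨B, hB⟩ : ∃ B, ∀ U, |S U| ≤ B := by
    obtain ⟨B, hB⟩ := (isCompact_range hS).isBounded.subset_closedBall 0
    exact ⟨B, fun U => by simpa [Real.dist_eq] using hB (Set.mem_range_self U)⟩
  obtain ⟨A, hA⟩ : ∃ A, ∀ U, |wilsonProd N s U| ≤ A := by
    obtain ⟨A, hA⟩ := (isCompact_range hW).isBounded.subset_closedBall 0
    exact ⟨A, fun U => by simpa [Real.dist_eq] using hA (Set.mem_range_self U)⟩
  have hnum : Continuous fun β : ℝ => ∫ U, wilsonProd N s U * Real.exp (N * β * S U) ∂(zdHaar d (SO N)) :=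
    continuous_iff_continuousAt.mpr fun β => (hasDerivAt_integral_mul_exp_soRep hS hW hB hA N β).continuousAt
  have hden : Continuous fun β : ℝ => ∫ U, (fun _ => (1 : ℝ)) U * Real.exp (N * β * S U) ∂(zdHaar d (SO N)) :=
    continuous_iff_continuousAt.mpr fun β =>
      (hasDerivAt_integral_mul_exp_soRep hS continuous_const hB (A := 1) (fun _ => by simp) N β).continuousAt
  have hden0 : ∀ β : ℝ, (∫ U, (fun _ => (1 : ℝ)) U * Real.exp (N * β * S U) ∂(zdHaar d (SO N))) ≠ 0 := by
    intro β
    have hlow : ∀ U, Real.exp (-(|(N : ℝ) * β| * B)) ≤ (fun _ => (1 : ℝ)) U * Real.exp (N * β * S U) := by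
      intro U
      simp only [one_mul]
      apply Real.exp_le_exp.mpr
      have : |(N : ℝ) * β * S U| ≤ |(N : ℝ) * β| * B := by
        rw [abs_mul]; exact mul_le_mul_of_nonneg_left (hB U) (abs_nonneg _)
      linarith [neg_abs_le ((N : ℝ) * β * S U)]
    refine ne_of_gt (lt_of_lt_of_le (Real.exp_pos (-(|(N : ℝ) * β| * B))) ?_)
    calc Real.exp (-(|(N : ℝ) * β| * B)) = ∫ _U, Real.exp (-(|(N : ℝ) * β| * B)) ∂(zdHaar d (SO N)) := by
          rw [integral_const, smul_eq_mul, probReal_univ, one_mul]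
      _ ≤ _ := integral_mono (integrable_const _) (integrable_zdHaar_of_continuous
          (continuous_const.mul (Real.continuous_exp.comp (continuous_const.mul hS)))) hlow
  have hφ : (fun β : ℝ => phi N β Λ s) = fun β =>
      (∫ U, wilsonProd N s U * Real.exp (N * β * S U) ∂(zdHaar d (SO N))) /
        (∫ U, (fun _ => (1 : ℝ)) U * Real.exp (N * β * S U) ∂(zdHaar d (SO N))) / (N : ℝ) ^ s.length := by
    funext β
    rw [phi, soExpect_eq_div]
    simp only [one_mul]
    rfl
  rw [hφ]
  exact ((hnum.div hden hden0).div_const _)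

/-! ## The averaged plaquette value -/

variable (d)

/-- ★ **The average plaquette value of a growing cube converges to `(d(d−1)/2)` times the string sum**: there is
`β₀(d) > 0` such that for `|t| ≤ β₀`, every `M_N → ∞` and every plaquette `p`,
`|Λ_N|⁻¹ Σ_{q ∈ 𝒫_{Λ_N}} φ_{Λ_N,N,t}((∂q)) → (d(d−1)/2) Σ_{X ∈ 𝒳((∂p))} w_t(X)`, `Λ_N = [−M_N, M_N]^d`.
[cite: Chatterjee2019LargeN, §15 (proof of Corollary 3.4: «each term … has the same value», «|𝒫'_N|/|Λ_N| → d(d−1)/2»)] -/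
theorem tendsto_avg_phi_plaquette (hd : 2 ≤ d) :
    ∃ β₀ : ℝ, 0 < β₀ ∧ ∀ M : ℕ → ℕ, Tendsto M atTop atTop → ∀ t : ℝ, |t| ≤ β₀ → ∀ p : ZdPlaquette d,
      Tendsto (fun N : ℕ => (∑ q ∈ plaquettesIn (box d (M N)),
          (if h : q.2.1 < q.2.2 then phi N t (box d (M N)) [plaquetteWord ⟨q.1, ⟨(q.2.1, q.2.2), h⟩⟩] else 0)) /
            (box d (M N)).card) atTop
        (𝓝 ((d : ℝ) * ((d : ℝ) - 1) / 2 * ∑' X : Trajectory [plaquetteWord p], X.weight t)) := by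
  obtain ⟨β₁, hβ₁, C, hC1, H1⟩ := abs_phi_sub_trajectorySum_le_of_ball d hd
  obtain ⟨β₂, hβ₂, H2⟩ := trajectorySum_plaquetteWord_eq d hd
  obtain ⟨β₃, hβ₃, H3⟩ := gaugeStringDuality_holds d hd
  refine ⟨min β₁ (min β₂ β₃), lt_min hβ₁ (lt_min hβ₂ hβ₃), fun M hM t ht p => ?_⟩
  have ht1 : |t| ≤ β₁ := ht.trans (min_le_left _ _)
  have ht2 : |t| ≤ β₂ := ht.trans ((min_le_right _ _).trans (min_le_left _ _))
  have ht3 : |t| ≤ β₃ := ht.trans ((min_le_right _ _).trans (min_le_right _ _))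
  set D : ℝ := (d : ℝ) * ((d : ℝ) - 1) / 2 with hDdef
  set T : ℝ := ∑' X : Trajectory [plaquetteWord p], X.weight t with hTdef
  have hD0 : 0 ≤ D := by rw [hDdef, ← card_pairsLT_real]; positivity
  -- `|T| ≤ 1` (a limit of quantities bounded by one)
  have hT1 : |T| ≤ 1 := by
    have hlim := (H3 (fun n => box d n) isExhaustion_box t ht3 [plaquetteWord p] (isLoopSeq_plaquette p)).2
    exact le_of_tendsto' hlim.abs fun n => abs_phi_le_one _ _ _ _
  have hTq : ∀ q : ZdPlaquette d, ∑' X : Trajectory [plaquetteWord q], X.weight t = T := fun q => H2 t ht2 q p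
  -- the summand
  set F : ℕ → Site d × Fin d × Fin d → ℝ := fun N q =>
    if h : q.2.1 < q.2.2 then phi N t (box d (M N)) [plaquetteWord ⟨q.1, ⟨(q.2.1, q.2.2), h⟩⟩] else 0 with hF
  have hF1 : ∀ N q, |F N q| ≤ 1 := by
    intro N q
    simp only [hF]
    split_ifs
    · exact abs_phi_le_one _ _ _ _
    · simp
  rw [Metric.tendsto_atTop]
  intro ε hε
  -- choose the depth `R`
  obtain ⟨R, hR⟩ : ∃ R : ℕ, D * C ^ 4 * (3 * (3 / 4 : ℝ) ^ R) < ε / 4 := by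
    have h := ((tendsto_pow_atTop_nhds_zero_of_lt_one (by norm_num : (0 : ℝ) ≤ 3 / 4)
      (by norm_num : (3 / 4 : ℝ) < 1)).const_mul (D * C ^ 4 * 3))
    rw [mul_zero] at h
    obtain ⟨R, hR⟩ := (h.eventually (gt_mem_nhds (by positivity : (0 : ℝ) < ε / 4))).exists
    exact ⟨R, by linarith [hR]⟩
  -- the quantities that become small with `N`
  have e1 : ∀ᶠ N : ℕ in atTop, 2 ≤ N := eventually_ge_atTop 2
  have e2 : ∀ᶠ N : ℕ in atTop, R + 1 ≤ M N := (tendsto_atTop.mp hM) (R + 1)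
  have e3 : ∀ᶠ N : ℕ in atTop, D * C ^ 4 * (20 / (N : ℝ)) < ε / 4 := by
    have h := (tendsto_const_div_atTop_nhds_zero_nat (20 : ℝ)).const_mul (D * C ^ 4)
    rw [mul_zero] at h
    exact h.eventually (gt_mem_nhds (by positivity))
  have e4 : ∀ᶠ N : ℕ in atTop, 2 * D * (1 - ((box d (M N - (R + 1))).card : ℝ) / (box d (M N)).card) < ε / 4 := by
    have h := ((tendsto_const_nhds (x := (1 : ℝ))).sub (tendsto_card_box_ratio (d := d) R hM)).const_mul (2 * D)
    rw [sub_self, mul_zero] at h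
    exact h.eventually (gt_mem_nhds (by positivity))
  obtain ⟨N₀, hN₀⟩ := eventually_atTop.mp (e1.and (e2.and (e3.and e4)))
  refine ⟨N₀, fun N hN => ?_⟩
  obtain ⟨hN2, hMR, hε3, hε4⟩ := hN₀ N hN
  -- notation for this `N`
  set Λ := box d (M N) with hΛ
  set P := plaquettesIn Λ with hP
  set I := box d (M N - (R + 1)) ×ˢ (Finset.univ.filter fun q : Fin d × Fin d => q.1 < q.2) with hI
  have hIP : I ⊆ P := by rw [hI, hP, hΛ]; exact box_product_subset_plaquettesIn hMR
  have hb : (0 : ℝ) < Λ.card := by exact_mod_cast card_box_pos (M N)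
  set ρ : ℝ := ((box d (M N - (R + 1))).card : ℝ) / Λ.card with hρ
  have hIcard : (I.card : ℝ) = D * (Λ.card * ρ) := by
    rw [hI, Finset.card_product, Nat.cast_mul, card_pairsLT_real, ← hDdef, hρ]
    field_simp
  have hPcard : (P.card : ℝ) ≤ Λ.card * D := card_plaquettesIn_le Λ
  have hρ1 : ρ ≤ 1 := by
    rw [hρ, div_le_one hb]
    exact_mod_cast Finset.card_le_card (fun y hy => by
      rw [mem_box_iff] at hy ⊢
      intro k
      have := hy k
      have hc : ((M N - (R + 1) : ℕ) : ℤ) ≤ M N := by exact_mod_cast Nat.sub_le (M N) (R + 1)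
      constructor <;> linarith [this.1, this.2])
  have hΛne : Λ.Nonempty := Finset.card_pos.mp (card_box_pos (M N))
  -- interior plaquettes: the rate theorem
  have hint : ∀ q ∈ I, |F N q - T| ≤ C ^ 4 * (3 * (3 / 4 : ℝ) ^ R + 20 / N) := by
    rintro ⟨x, i, j⟩ hq
    rw [hI, Finset.mem_product, Finset.mem_filter] at hq
    obtain ⟨hx, -, hij⟩ := hq
    simp only [hF, dif_pos hij]
    rw [← hTq ⟨x, ⟨(i, j), hij⟩⟩]
    have h := H1 Λ hΛne N hN2 t ht1 R [plaquetteWord ⟨x, ⟨(i, j), hij⟩⟩] (isLoopSeq_plaquette _)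
      (ball_plaquetteWord_box hMR hx ⟨(i, j), hij⟩)
    simpa [LoopSeq.len, plaquetteWord] using h
  -- the estimate
  have hsplit : ∑ q ∈ P, F N q = ∑ q ∈ I, F N q + ∑ q ∈ P \ I, F N q := by
    rw [← Finset.sum_sdiff hIP, add_comm]
  have hA : |∑ q ∈ I, F N q - I.card * T| ≤ I.card * (C ^ 4 * (3 * (3 / 4 : ℝ) ^ R + 20 / N)) := by
    calc |∑ q ∈ I, F N q - I.card * T| = |∑ q ∈ I, (F N q - T)| := by
          rw [Finset.sum_sub_distrib, Finset.sum_const, nsmul_eq_mul]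
      _ ≤ ∑ q ∈ I, |F N q - T| := Finset.abs_sum_le_sum_abs _ _
      _ ≤ ∑ _q ∈ I, C ^ 4 * (3 * (3 / 4 : ℝ) ^ R + 20 / N) := Finset.sum_le_sum hint
      _ = I.card * (C ^ 4 * (3 * (3 / 4 : ℝ) ^ R + 20 / N)) := by rw [Finset.sum_const, nsmul_eq_mul]
  have hB : |∑ q ∈ P \ I, F N q| ≤ P.card - I.card := by
    calc |∑ q ∈ P \ I, F N q| ≤ ∑ q ∈ P \ I, |F N q| := Finset.abs_sum_le_sum_abs _ _
      _ ≤ ∑ _q ∈ P \ I, (1 : ℝ) := Finset.sum_le_sum fun q _ => hF1 N q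
      _ = ((P \ I).card : ℝ) := by rw [Finset.sum_const, nsmul_eq_mul, mul_one]
      _ = P.card - I.card := by rw [Finset.card_sdiff_of_subset hIP, Nat.cast_sub (Finset.card_le_card hIP)]
  have hmain : |∑ q ∈ P, F N q - D * Λ.card * T| ≤
      I.card * (C ^ 4 * (3 * (3 / 4 : ℝ) ^ R + 20 / N)) + 2 * (D * Λ.card - I.card) := by
    have hdiff : ∑ q ∈ P, F N q - D * Λ.card * T =
        (∑ q ∈ I, F N q - I.card * T) + ∑ q ∈ P \ I, F N q + (I.card - D * Λ.card) * T := by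
      rw [hsplit]; ring
    rw [hdiff]
    have h3 : |(I.card - D * Λ.card) * T| ≤ D * Λ.card - I.card := by
      rw [abs_mul]
      have hIle : (I.card : ℝ) ≤ D * Λ.card := by rw [hIcard]; nlinarith
      calc |(I.card : ℝ) - D * Λ.card| * |T| ≤ |(I.card : ℝ) - D * Λ.card| * 1 :=
            mul_le_mul_of_nonneg_left hT1 (abs_nonneg _)
        _ = D * Λ.card - I.card := by rw [mul_one, abs_sub_comm, abs_of_nonneg (by linarith)]
    calc |(∑ q ∈ I, F N q - I.card * T) + ∑ q ∈ P \ I, F N q + (I.card - D * Λ.card) * T|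
        ≤ |∑ q ∈ I, F N q - I.card * T| + |∑ q ∈ P \ I, F N q| + |(I.card - D * Λ.card) * T| := abs_add_three _ _ _
      _ ≤ I.card * (C ^ 4 * (3 * (3 / 4 : ℝ) ^ R + 20 / N)) + (P.card - I.card) + (D * Λ.card - I.card) :=
          add_le_add (add_le_add hA hB) h3
      _ ≤ I.card * (C ^ 4 * (3 * (3 / 4 : ℝ) ^ R + 20 / N)) + 2 * (D * Λ.card - I.card) := by linarith
  -- divide by `|Λ|`
  rw [Real.dist_eq]
  have hgoal : |(∑ q ∈ P, F N q) / Λ.card - D * T| ≤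
      ρ * D * (C ^ 4 * (3 * (3 / 4 : ℝ) ^ R + 20 / N)) + 2 * D * (1 - ρ) := by
    have h := div_le_div_of_nonneg_right hmain hb.le
    rw [← abs_of_pos hb, ← abs_div, abs_of_pos hb] at h
    have e1 : (∑ q ∈ P, F N q - D * Λ.card * T) / Λ.card = (∑ q ∈ P, F N q) / Λ.card - D * T := by
      field_simp
    have e2 : (I.card * (C ^ 4 * (3 * (3 / 4 : ℝ) ^ R + 20 / N)) + 2 * (D * Λ.card - I.card)) / Λ.card =
        ρ * D * (C ^ 4 * (3 * (3 / 4 : ℝ) ^ R + 20 / N)) + 2 * D * (1 - ρ) := by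
      rw [hIcard]
      field_simp
    rw [e1, e2] at h
    exact h
  have hρ0 : 0 ≤ ρ := by rw [hρ]; positivity
  calc |(∑ q ∈ P, F N q) / Λ.card - D * T|
      ≤ ρ * D * (C ^ 4 * (3 * (3 / 4 : ℝ) ^ R + 20 / N)) + 2 * D * (1 - ρ) := hgoal
    _ ≤ 1 * D * (C ^ 4 * (3 * (3 / 4 : ℝ) ^ R + 20 / N)) + 2 * D * (1 - ρ) := by
        gcongr
    _ = D * C ^ 4 * (3 * (3 / 4 : ℝ) ^ R) + D * C ^ 4 * (20 / N) + 2 * D * (1 - ρ) := by ring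
    _ < ε / 4 + ε / 4 + ε / 4 := by linarith
    _ < ε := by linarith

end StringDuality

end Summit.QuantumFields.GaugeBoot

end
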